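import Summits.Ventures.HSemireg.WedgeHankelTwoFiniteNodes

/-!
# Venture HSemireg — THE SECOND SYMMETRY GROUP: MIXING THE PAIRS (`x_a ↦ Σ_b M_{ba} x_b`, `y_a ↦ Σ_b M_{ba} y_b`, the same `M ∈ M_n(K)` on both letters) — th-7's class is an
# EIGENVECTOR of every pair scaling, is FIXED by every upward pair transvection, and CHANGES SIGN under every adjacent pair swap (the generators of `GL_n`; `det`-semi-invariance next)

HONEST FRAMING. Part of the Lean index of the computation cell `pub-hsemireg` (seat p10 gen 18, Sunday typer «UNIFORM-IN-n»).
Finite-dimensional EXTERIOR ALGEBRA over a field ONLY: no variety, no cohomology theory, no sheaf, no Ext group, no semiregularity map;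
nothing here says that HC / HC_CM / HC_AV holds; no Literature fact is declared or used.  Custodian versions as in `WedgeHankelSiegelIdeal` (1/3) and `WedgeHankelFrameChange`;
the dictionary (the generators `x_a, y_a` = a frame `∂_a, dz̄_a` adapted to a splitting; `M ∈ GL_n` = a change of that frame inside each factor, the same on both; th-7's class = the top
wedge of the `n` vectors `u x_a + v y_a`, hence a `det`-semi-invariant) is QUOTED, never asserted.

WHAT IS IN THE TREE.  Gens 15–18 typed the FIRST symmetry group — the `2 × 2` substitutions of the letters `(x, y)`, the same on every pair (`GL₂`: E5/E7/E12/F1/F5, H1 `Sb`).  The pairs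
themselves were only ever touched one at a time (th-7's recursion `w_{m+1}(q) = w_m(q) x_m + w_m(σq) y_m`, gen 11's OLD-PAIR LEMMA `w_mul_X_add`: `w_j(q) x_a + w_j(σq) y_a = 0` for `a < j`).
THIS FILE types the generators of the SECOND symmetry group `GL_n` (mixing the pairs; namespace `Summit.Ventures.HSemireg.Wedge.HankelPairMixing`, new):
* §147 `pmLin M` (`e_{x_a} ↦ Σ_b M_{ba} e_{x_b}`, `e_{y_a} ↦ Σ_b M_{ba} e_{y_b}`: column `a` = image of pair `a`) and the algebra endomorphism **`Pm M := ExteriorAlgebra.map (pmLin M)`** (`Pm_X`, `Pm_Y`;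
  every `M`, singular included); **`Pm_mul`: `Pm (M·N) = Pm M ∘ Pm N`**, `Pm_one`.
* §148 THREE RECURSION THEOREMS for an arbitrary algebra endomorphism `F` given on the letters: **`map_w_of_scale`** (`F x_c = d_c x_c`, `F y_c = d_c y_c` for `c < m` ⇒ `F(w_m q) = (Π_{c<m} d_c)·w_m q`;
  `map_w_of_fix`), **`map_w_of_transvect`** (`F` adds `c·`(pair `i`) to pair `j` with `i < j` and fixes the other pairs ⇒ `F(w_m q) = w_m q` for EVERY `m` — th-7's recursion plus the old-pair
  lemma at the step `m = j`), **`map_w_of_swap_adj`** (`F` exchanges the pairs `c, c+1` and fixes the others ⇒ `F(w_m q) = −w_m q` for every `m ≥ c + 2` — the two-step recursion is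
  antisymmetric in consecutive pairs).
* §149 the matrix instances: **`Pm_diagonal_w`: `Pm (diagonal d) (w_n q) = (Π_a d_a)·w_n q = det(diagonal d)·w_n q`**, **`Pm_transvection_w`: `Pm (transvection i j c) (w_n q) = w_n q` for `i < j`**
  (Mathlib's `transvection i j c = 1 + single i j c`: pair `j ↦` pair `j + c·`pair `i`), and the pair-swap permutation matrices `swapMat i j` (`Pm_swapMat_X`: `x_a ↦ x_{swap a}`) with
  **`Pm_swapMat_adj_w`: `Pm (swapMat c (c+1)) (w_n q) = −w_n q`** (`c + 1 < n`).
NOT typed here (next leaf): downward transvections `i > j` (by conjugation with swaps), `Pm M (w_n q) = det M · w_n q` for EVERY `M` (Mathlib's transvection–diagonal induction), and the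
consequence that every kernel `Kr(univ, w_n q, k)` is a `GL_n`-STABLE subspace; anything Ext-side.  Class side only; new names only.
-/

open Module

namespace Summit.Ventures.HSemireg.Wedge.HankelPairMixing

open Summit.Ventures.HSemireg.Wedge Summit.Ventures.HSemireg.Wedge.Kunneth Summit.Ventures.HSemireg.Wedge.Hankel
  Summit.Ventures.HSemireg.Wedge.BasisFree Summit.Ventures.HSemireg.Wedge.HankelSiegel Summit.Ventures.HSemireg.Wedge.HankelSiegelIdeal
  Summit.Ventures.HSemireg.Wedge.KunnethKernel Summit.Ventures.HSemireg.Wedge.HankelFrameChange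

variable (K : Type*) [Field K] {n : ℕ}

/-! ## §147. Mixing the pairs: the endomorphism of a matrix -/

/-- **the pair-mixing map on the generators**: `e_{x_a} ↦ Σ_b M_{ba} e_{x_b}`, `e_{y_a} ↦ Σ_b M_{ba} e_{y_b}` (column `a` of `M` = the image of pair `a`, on both letters). -/
noncomputable def pmLin (M : Matrix (Fin n) (Fin n) K) : (In n → K) →ₗ[K] (In n → K) :=
  (b K (In n)).constr K fun i : In n =>
    if h : (i : ℕ) < n then ∑ c : Fin n, M c ⟨i, h⟩ • b K (In n) (Fin.castAdd n c)
    else ∑ c : Fin n, M c ⟨(i : ℕ) - n, by have := i.2; omega⟩ • b K (In n) (Fin.natAdd n c)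

/-- the image of `e_{x_a}`. -/
lemma pmLin_b_castAdd (M : Matrix (Fin n) (Fin n) K) (a : Fin n) :
    pmLin K M (b K (In n) (Fin.castAdd n a)) = ∑ c : Fin n, M c a • b K (In n) (Fin.castAdd n c) := by
  rw [pmLin, Basis.constr_basis]
  have h : ((Fin.castAdd n a : In n) : ℕ) < n := by rw [Fin.val_castAdd]; exact a.2
  have e : (⟨((Fin.castAdd n a : In n) : ℕ), h⟩ : Fin n) = a := Fin.ext (by simp)
  rw [dif_pos h, e]

/-- the image of `e_{y_a}`. -/
lemma pmLin_b_natAdd (M : Matrix (Fin n) (Fin n) K) (a : Fin n) :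
    pmLin K M (b K (In n) (Fin.natAdd n a)) = ∑ c : Fin n, M c a • b K (In n) (Fin.natAdd n c) := by
  rw [pmLin, Basis.constr_basis]
  have h : ¬ ((Fin.natAdd n a : In n) : ℕ) < n := by rw [Fin.val_natAdd]; omega
  have e : (⟨((Fin.natAdd n a : In n) : ℕ) - n, by have := (Fin.natAdd n a : In n).2; omega⟩ : Fin n) = a := Fin.ext (by simp)
  rw [dif_neg h, e]

/-- **THE PAIR-MIXING ENDOMORPHISM `Pm M := ExteriorAlgebra.map (pmLin M)`** of `⋀(K^{2n})` (every `M`, singular included). -/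
noncomputable def Pm (M : Matrix (Fin n) (Fin n) K) : HT K (In n) →ₐ[K] HT K (In n) := ExteriorAlgebra.map (pmLin K M)

/-- `Pm M (ι v) = ι (pmLin M v)`. -/
lemma Pm_ι (M : Matrix (Fin n) (Fin n) K) (v : In n → K) : Pm K M (ExteriorAlgebra.ι K v) = ExteriorAlgebra.ι K (pmLin K M v) :=
  ExteriorAlgebra.map_apply_ι _ _

/-- **`Pm M (x_a) = Σ_b M_{ba} x_b`.** -/
theorem Pm_X (M : Matrix (Fin n) (Fin n) K) (a : Fin n) : Pm K M (X K n a) = ∑ c : Fin n, M c a • X K n c := by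
  rw [X_fin, Pm_ι, pmLin_b_castAdd, map_sum]
  exact Finset.sum_congr rfl fun c _ => by rw [map_smul, ← X_fin]

/-- **`Pm M (y_a) = Σ_b M_{ba} y_b`.** -/
theorem Pm_Y (M : Matrix (Fin n) (Fin n) K) (a : Fin n) : Pm K M (Y K n a) = ∑ c : Fin n, M c a • Y K n c := by
  rw [Y_fin, Pm_ι, pmLin_b_natAdd, map_sum]
  exact Finset.sum_congr rfl fun c _ => by rw [map_smul, ← Y_fin]

/-- **`Pm (M·N) = Pm M ∘ Pm N`** (column convention: covariant). -/
theorem Pm_mul (M N : Matrix (Fin n) (Fin n) K) : Pm K (M * N) = (Pm K M).comp (Pm K (n := n) N) :=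
  algHom_ext_XY K
    (fun a => by
      rw [Pm_X, AlgHom.comp_apply, Pm_X, map_sum]
      simp_rw [map_smul, Pm_X, Finset.smul_sum, smul_smul, Matrix.mul_apply, Finset.sum_smul]
      rw [Finset.sum_comm]
      exact Finset.sum_congr rfl fun c _ => Finset.sum_congr rfl fun d _ => by rw [mul_comm])
    (fun a => by
      rw [Pm_Y, AlgHom.comp_apply, Pm_Y, map_sum]
      simp_rw [map_smul, Pm_Y, Finset.smul_sum, smul_smul, Matrix.mul_apply, Finset.sum_smul]
      rw [Finset.sum_comm]
      exact Finset.sum_congr rfl fun c _ => Finset.sum_congr rfl fun d _ => by rw [mul_comm])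

/-- **`Pm 1 = id`.** -/
theorem Pm_one : Pm K (1 : Matrix (Fin n) (Fin n) K) = AlgHom.id K (HT K (In n)) :=
  algHom_ext_XY K
    (fun a => by
      rw [Pm_X, AlgHom.id_apply, Finset.sum_eq_single a]
      · rw [Matrix.one_apply_eq, one_smul]
      · intro c _ hc; rw [Matrix.one_apply_ne hc, zero_smul]
      · intro h; exact absurd (Finset.mem_univ a) h)
    (fun a => by
      rw [Pm_Y, AlgHom.id_apply, Finset.sum_eq_single a]
      · rw [Matrix.one_apply_eq, one_smul]
      · intro c _ hc; rw [Matrix.one_apply_ne hc, zero_smul]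
      · intro h; exact absurd (Finset.mem_univ a) h)

/-! ## §148. Three recursion theorems -/

/-- **SCALING THE PAIRS: an algebra endomorphism with `F x_c = d_c x_c`, `F y_c = d_c y_c` for all `c < m` multiplies `w_m(q)` by `Π_{c<m} d_c`** (th-7's recursion; every `q`). -/
theorem map_w_of_scale (F : HT K (In n) →ₐ[K] HT K (In n)) (d : ℕ → K) :
    ∀ (m : ℕ), (∀ c < m, F (X K n c) = d c • X K n c) → (∀ c < m, F (Y K n c) = d c • Y K n c) →
      ∀ q : ℕ → K, F (w K n m q) = (∏ c ∈ Finset.range m, d c) • w K n m q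
  | 0, _, _, q => by rw [w, map_smul, map_one, Finset.prod_range_zero, one_smul]
  | m + 1, hX, hY, q => by
    have ihq := map_w_of_scale F d m (fun c hc => hX c (by omega)) (fun c hc => hY c (by omega)) q
    have ihs := map_w_of_scale F d m (fun c hc => hX c (by omega)) (fun c hc => hY c (by omega)) (shift K q)
    rw [w, map_add, map_mul, map_mul, ihq, ihs, hX m (Nat.lt_succ_self m), hY m (Nat.lt_succ_self m), Finset.prod_range_succ, smul_mul_smul_comm, smul_mul_smul_comm,
      ← smul_add]

/-- in particular **an endomorphism fixing the letters of the first `m` pairs fixes `w_m(q)`.** -/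
theorem map_w_of_fix (F : HT K (In n) →ₐ[K] HT K (In n)) (m : ℕ) (hX : ∀ c < m, F (X K n c) = X K n c) (hY : ∀ c < m, F (Y K n c) = Y K n c) (q : ℕ → K) :
    F (w K n m q) = w K n m q := by
  have h := map_w_of_scale K F (fun _ => 1) m (fun c hc => by rw [one_smul]; exact hX c hc) (fun c hc => by rw [one_smul]; exact hY c hc) q
  rwa [Finset.prod_const_one, one_smul] at h

/-- **UPWARD PAIR TRANSVECTIONS FIX THE CLASS**: if `F` adds `c·`(pair `i`) to pair `j` with `i < j` (`F x_j = x_j + c x_i`, `F y_j = y_j + c y_i`) and fixes every other pair, then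
`F (w_m q) = w_m q` for EVERY `m` and `q` — at the step `m = j` of th-7's recursion the extra term is `c·(w_j(q) x_i + w_j(σq) y_i) = 0` by gen 11's OLD-PAIR LEMMA. -/
theorem map_w_of_transvect (F : HT K (In n) →ₐ[K] HT K (In n)) {i j : ℕ} (hij : i < j) (c : K) (hXj : F (X K n j) = X K n j + c • X K n i)
    (hYj : F (Y K n j) = Y K n j + c • Y K n i) (hX : ∀ a, a ≠ j → F (X K n a) = X K n a) (hY : ∀ a, a ≠ j → F (Y K n a) = Y K n a) :
    ∀ (m : ℕ) (q : ℕ → K), F (w K n m q) = w K n m q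
  | 0, q => by rw [w, map_smul, map_one]
  | m + 1, q => by
    rw [w, map_add, map_mul, map_mul, map_w_of_transvect F hij c hXj hYj hX hY m q, map_w_of_transvect F hij c hXj hYj hX hY m (shift K q)]
    by_cases hm : m = j
    · subst hm
      rw [hXj, hYj, mul_add, mul_add, mul_smul_comm, mul_smul_comm, add_add_add_comm, ← smul_add, w_mul_X_add K hij, smul_zero, add_zero]
    · rw [hX m hm, hY m hm]

/-- the two-step expansion of th-7's recursion. -/
lemma w_add_two (m : ℕ) (q : ℕ → K) :
    w K n (m + 2) q = (w K n m q * X K n m + w K n m (shift K q) * Y K n m) * X K n (m + 1) +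
      (w K n m (shift K q) * X K n m + w K n m (shift K (shift K q)) * Y K n m) * Y K n (m + 1) := rfl

/-- **ADJACENT PAIR SWAPS CHANGE THE SIGN**: if `F` exchanges the letters of the pairs `c` and `c + 1` (`x_c ↔ x_{c+1}`, `y_c ↔ y_{c+1}`) and fixes every other pair, then
`F (w_m q) = −w_m q` for every `m ≥ c + 2` (and `= w_m q` for `m ≤ c`) — the two-step recursion is antisymmetric in two consecutive pairs (anticommutation only). -/
theorem map_w_of_swap_adj (F : HT K (In n) →ₐ[K] HT K (In n)) {c : ℕ} (hXc : F (X K n c) = X K n (c + 1)) (hXc' : F (X K n (c + 1)) = X K n c)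
    (hYc : F (Y K n c) = Y K n (c + 1)) (hYc' : F (Y K n (c + 1)) = Y K n c) (hX : ∀ a, a ≠ c → a ≠ c + 1 → F (X K n a) = X K n a)
    (hY : ∀ a, a ≠ c → a ≠ c + 1 → F (Y K n a) = Y K n a) : ∀ (d : ℕ) (q : ℕ → K), F (w K n (c + 2 + d) q) = -w K n (c + 2 + d) q
  | 0, q => by
    have hfix : ∀ r : ℕ → K, F (w K n c r) = w K n c r := fun r =>
      map_w_of_fix K F c (fun a ha => hX a (by omega) (by omega)) (fun a ha => hY a (by omega) (by omega)) r
    rw [Nat.add_zero, w_add_two]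
    simp only [map_add, map_mul, hfix, hXc, hXc', hYc, hYc']
    have h1 := anticomm_of_gen (X_gen K (n := n) (c + 1)) (X_gen K (n := n) c)
    have h2 := anticomm_of_gen (Y_gen K (n := n) (c + 1)) (X_gen K (n := n) c)
    have h3 := anticomm_of_gen (X_gen K (n := n) (c + 1)) (Y_gen K (n := n) c)
    have h4 := anticomm_of_gen (Y_gen K (n := n) (c + 1)) (Y_gen K (n := n) c)
    calc (w K n c q * X K n (c + 1) + w K n c (shift K q) * Y K n (c + 1)) * X K n c +
          (w K n c (shift K q) * X K n (c + 1) + w K n c (shift K (shift K q)) * Y K n (c + 1)) * Y K n c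
        = w K n c q * (X K n (c + 1) * X K n c) + w K n c (shift K q) * (Y K n (c + 1) * X K n c) +
            w K n c (shift K q) * (X K n (c + 1) * Y K n c) + w K n c (shift K (shift K q)) * (Y K n (c + 1) * Y K n c) := by noncomm_ring
      _ = -((w K n c q * X K n c + w K n c (shift K q) * Y K n c) * X K n (c + 1) +
            (w K n c (shift K q) * X K n c + w K n c (shift K (shift K q)) * Y K n c) * Y K n (c + 1)) := by
          rw [h1, h2, h3, h4]; noncomm_ring
  | d + 1, q => by
    rw [show c + 2 + (d + 1) = (c + 2 + d) + 1 by omega, w, map_add, map_mul, map_mul, map_w_of_swap_adj F hXc hXc' hYc hYc' hX hY d q,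
      map_w_of_swap_adj F hXc hXc' hYc hYc' hX hY d (shift K q), hX (c + 2 + d) (by omega) (by omega), hY (c + 2 + d) (by omega) (by omega)]
    noncomm_ring

/-! ## §149. The matrix instances: diagonal, upward transvection, adjacent swap -/

/-- `Pm M` on `X_c`, `ℕ`-indexed (`0 = 0` beyond `n`). -/
lemma Pm_X' (M : Matrix (Fin n) (Fin n) K) (c : ℕ) (hc : c < n) : Pm K M (X K n c) = ∑ b : Fin n, M b ⟨c, hc⟩ • X K n b := Pm_X K M ⟨c, hc⟩

/-- `Pm M` on `Y_c`, `ℕ`-indexed. -/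
lemma Pm_Y' (M : Matrix (Fin n) (Fin n) K) (c : ℕ) (hc : c < n) : Pm K M (Y K n c) = ∑ b : Fin n, M b ⟨c, hc⟩ • Y K n b := Pm_Y K M ⟨c, hc⟩

/-- **DIAGONAL MATRICES: `Pm (diagonal d) (w_n q) = det (diagonal d) · w_n q`** (each monomial has exactly one letter from each pair). -/
theorem Pm_diagonal_w (d : Fin n → K) (q : ℕ → K) : Pm K (Matrix.diagonal d) (w K n n q) = (Matrix.diagonal d).det • w K n n q := by
  set dd : ℕ → K := fun c => if h : c < n then d ⟨c, h⟩ else 1 with hdd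
  have hXd : ∀ c < n, Pm K (Matrix.diagonal d) (X K n c) = dd c • X K n c := fun c hc => by
    rw [Pm_X' K _ c hc, Finset.sum_eq_single ⟨c, hc⟩, Matrix.diagonal_apply_eq, hdd]
    · simp only [dif_pos hc]
    · intro b _ hb; rw [Matrix.diagonal_apply_ne _ hb, zero_smul]
    · intro h; exact absurd (Finset.mem_univ _) h
  have hYd : ∀ c < n, Pm K (Matrix.diagonal d) (Y K n c) = dd c • Y K n c := fun c hc => by
    rw [Pm_Y' K _ c hc, Finset.sum_eq_single ⟨c, hc⟩, Matrix.diagonal_apply_eq, hdd]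
    · simp only [dif_pos hc]
    · intro b _ hb; rw [Matrix.diagonal_apply_ne _ hb, zero_smul]
    · intro h; exact absurd (Finset.mem_univ _) h
  rw [map_w_of_scale K _ dd n hXd hYd q, Matrix.det_diagonal, ← Fin.prod_univ_eq_prod_range]
  congr 1
  exact Finset.prod_congr rfl fun c _ => by rw [hdd]; simp only [dif_pos c.2]

/-- the columns of Mathlib's `transvection i j c = 1 + single i j c`. -/
lemma transvection_apply' (i j : Fin n) (c : K) (a b : Fin n) :
    Matrix.transvection i j c b a = (if b = a then 1 else 0) + if i = b ∧ j = a then c else 0 := by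
  rw [Matrix.transvection, Matrix.add_apply, Matrix.one_apply, Matrix.single_apply]

/-- **`Pm (transvection i j c) (x_a) = x_a + [a = j]·c·x_i`**: pair `j ↦` pair `j + c·`pair `i`, the other pairs fixed. -/
theorem Pm_transvection_X (i j : Fin n) (c : K) (a : Fin n) :
    Pm K (Matrix.transvection i j c) (X K n a) = X K n a + (if a = j then c • X K n i else 0) := by
  rw [Pm_X]
  simp_rw [transvection_apply', add_smul, Finset.sum_add_distrib, ite_smul, one_smul, zero_smul, Finset.sum_ite_eq' Finset.univ a, if_pos (Finset.mem_univ _)]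
  congr 1
  by_cases ha : a = j
  · rw [if_pos ha]
    have e : ∀ b : Fin n, (if i = b ∧ j = a then c • X K n b else 0) = if i = b then c • X K n b else 0 := fun b => by
      rw [if_congr (and_iff_left ha.symm) rfl rfl]
    simp_rw [e]
    rw [Finset.sum_ite_eq, if_pos (Finset.mem_univ _)]
  · rw [if_neg ha]
    exact Finset.sum_eq_zero fun b _ => by rw [if_neg (fun h => ha h.2.symm)]

/-- **`Pm (transvection i j c) (y_a) = y_a + [a = j]·c·y_i`.** -/
theorem Pm_transvection_Y (i j : Fin n) (c : K) (a : Fin n) :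
    Pm K (Matrix.transvection i j c) (Y K n a) = Y K n a + (if a = j then c • Y K n i else 0) := by
  rw [Pm_Y]
  simp_rw [transvection_apply', add_smul, Finset.sum_add_distrib, ite_smul, one_smul, zero_smul, Finset.sum_ite_eq' Finset.univ a, if_pos (Finset.mem_univ _)]
  congr 1
  by_cases ha : a = j
  · rw [if_pos ha]
    have e : ∀ b : Fin n, (if i = b ∧ j = a then c • Y K n b else 0) = if i = b then c • Y K n b else 0 := fun b => by
      rw [if_congr (and_iff_left ha.symm) rfl rfl]
    simp_rw [e]
    rw [Finset.sum_ite_eq, if_pos (Finset.mem_univ _)]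
  · rw [if_neg ha]
    exact Finset.sum_eq_zero fun b _ => by rw [if_neg (fun h => ha h.2.symm)]

/-- `ℕ`-indexed: `Pm (transvection i j c)` fixes `X_a` for `a ≠ j` (also beyond `n`). -/
lemma Pm_transvection_X_of_ne (i j : Fin n) (c : K) {a : ℕ} (ha : a ≠ (j : ℕ)) : Pm K (Matrix.transvection i j c) (X K n a) = X K n a := by
  by_cases han : a < n
  · have h := Pm_transvection_X K i j c ⟨a, han⟩
    rw [if_neg (fun e => ha (congrArg Fin.val e)), add_zero] at h
    exact h
  · rw [X, dif_neg han, map_zero]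

/-- `ℕ`-indexed: `Pm (transvection i j c)` fixes `Y_a` for `a ≠ j`. -/
lemma Pm_transvection_Y_of_ne (i j : Fin n) (c : K) {a : ℕ} (ha : a ≠ (j : ℕ)) : Pm K (Matrix.transvection i j c) (Y K n a) = Y K n a := by
  by_cases han : a < n
  · have h := Pm_transvection_Y K i j c ⟨a, han⟩
    rw [if_neg (fun e => ha (congrArg Fin.val e)), add_zero] at h
    exact h
  · rw [Y, dif_neg han, map_zero]

/-- **UPWARD TRANSVECTIONS FIX THE CLASS: `Pm (transvection i j c) (w_n q) = w_n q` for `i < j`** (§148 with the old-pair lemma). -/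
theorem Pm_transvection_w {i j : Fin n} (hij : i < j) (c : K) (q : ℕ → K) : Pm K (Matrix.transvection i j c) (w K n n q) = w K n n q := by
  refine map_w_of_transvect K _ (i := (i : ℕ)) (j := (j : ℕ)) hij c ?_ ?_ (fun a ha => Pm_transvection_X_of_ne K i j c ha)
    (fun a ha => Pm_transvection_Y_of_ne K i j c ha) n q
  · have h := Pm_transvection_X K i j c j; rwa [if_pos rfl] at h
  · have h := Pm_transvection_Y K i j c j; rwa [if_pos rfl] at h

/-- the PERMUTATION MATRIX of the pair swap `i ↔ j` (column `a` = `e_{swap a}`). -/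
def swapMat (i j : Fin n) : Matrix (Fin n) (Fin n) K := Matrix.of fun b a => if b = Equiv.swap i j a then (1 : K) else 0

/-- **`Pm (swapMat i j) (x_a) = x_{swap i j a}`.** -/
theorem Pm_swapMat_X (i j a : Fin n) : Pm K (swapMat K i j) (X K n a) = X K n (Equiv.swap i j a) := by
  rw [Pm_X]
  simp only [swapMat, Matrix.of_apply, ite_smul, one_smul, zero_smul, Finset.sum_ite_eq', Finset.mem_univ, if_true]

/-- **`Pm (swapMat i j) (y_a) = y_{swap i j a}`.** -/
theorem Pm_swapMat_Y (i j a : Fin n) : Pm K (swapMat K i j) (Y K n a) = Y K n (Equiv.swap i j a) := by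
  rw [Pm_Y]
  simp only [swapMat, Matrix.of_apply, ite_smul, one_smul, zero_smul, Finset.sum_ite_eq', Finset.mem_univ, if_true]

/-- `ℕ`-indexed action of a pair swap on `X_a`: `a ↦ j` if `a = i`, `a ↦ i` if `a = j`, fixed otherwise (and `0 = 0` beyond `n`). -/
lemma Pm_swapMat_X' (i j : Fin n) (a : ℕ) :
    Pm K (swapMat K i j) (X K n a) = X K n (if a = (i : ℕ) then (j : ℕ) else if a = (j : ℕ) then (i : ℕ) else a) := by
  by_cases han : a < n
  · have h := Pm_swapMat_X K i j ⟨a, han⟩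
    rw [Equiv.swap_apply_def] at h
    rw [show X K n a = X K n ((⟨a, han⟩ : Fin n) : ℕ) from rfl, h]
    by_cases hi : a = (i : ℕ)
    · rw [if_pos (Fin.ext hi), if_pos hi]
    · rw [if_neg (fun e => hi (congrArg Fin.val e)), if_neg hi]
      by_cases hj : a = (j : ℕ)
      · rw [if_pos (Fin.ext hj), if_pos hj]
      · rw [if_neg (fun e => hj (congrArg Fin.val e)), if_neg hj]
  · have hi : a ≠ (i : ℕ) := fun e => han (e ▸ i.2)
    have hj : a ≠ (j : ℕ) := fun e => han (e ▸ j.2)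
    rw [if_neg hi, if_neg hj, X, dif_neg han, map_zero]

/-- `ℕ`-indexed action of a pair swap on `Y_a`. -/
lemma Pm_swapMat_Y' (i j : Fin n) (a : ℕ) :
    Pm K (swapMat K i j) (Y K n a) = Y K n (if a = (i : ℕ) then (j : ℕ) else if a = (j : ℕ) then (i : ℕ) else a) := by
  by_cases han : a < n
  · have h := Pm_swapMat_Y K i j ⟨a, han⟩
    rw [Equiv.swap_apply_def] at h
    rw [show Y K n a = Y K n ((⟨a, han⟩ : Fin n) : ℕ) from rfl, h]
    by_cases hi : a = (i : ℕ)
    · rw [if_pos (Fin.ext hi), if_pos hi]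
    · rw [if_neg (fun e => hi (congrArg Fin.val e)), if_neg hi]
      by_cases hj : a = (j : ℕ)
      · rw [if_pos (Fin.ext hj), if_pos hj]
      · rw [if_neg (fun e => hj (congrArg Fin.val e)), if_neg hj]
  · have hi : a ≠ (i : ℕ) := fun e => han (e ▸ i.2)
    have hj : a ≠ (j : ℕ) := fun e => han (e ▸ j.2)
    rw [if_neg hi, if_neg hj, Y, dif_neg han, map_zero]

/-- **ADJACENT PAIR SWAPS: `Pm (swapMat c (c+1)) (w_n q) = −w_n q`** (`c + 1 < n`). -/
theorem Pm_swapMat_adj_w {c : ℕ} (hc : c + 1 < n) (q : ℕ → K) :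
    Pm K (swapMat K (⟨c, by omega⟩ : Fin n) ⟨c + 1, hc⟩) (w K n n q) = -w K n n q := by
  obtain ⟨d, hd⟩ : ∃ d, n = c + 2 + d := ⟨n - (c + 2), by omega⟩
  have hX := Pm_swapMat_X' K (n := n) ⟨c, by omega⟩ ⟨c + 1, hc⟩
  have hY := Pm_swapMat_Y' K (n := n) ⟨c, by omega⟩ ⟨c + 1, hc⟩
  dsimp only at hX hY
  have h := map_w_of_swap_adj K (Pm K (swapMat K (⟨c, by omega⟩ : Fin n) ⟨c + 1, hc⟩)) (c := c)
    (by rw [hX, if_pos rfl]) (by rw [hX, if_neg (by omega), if_pos rfl]) (by rw [hY, if_pos rfl]) (by rw [hY, if_neg (by omega), if_pos rfl])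
    (fun a h1 h2 => by rw [hX, if_neg h1, if_neg h2]) (fun a h1 h2 => by rw [hY, if_neg h1, if_neg h2]) d q
  rw [← hd] at h
  exact h

end Summit.Ventures.HSemireg.Wedge.HankelPairMixing
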